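import Summits.QuantumFields.YangMills.Theorems.BalabanUVNodesN22W1StripN18Edge
import Summits.QuantumFields.YangMills.Theorems.BalabanUVNodesRateCarriersOfRecord12On

/-!
# THE K4-INTERNAL EDGE N18 → N22 AT THE NAMED W1 READING — AT THE REGIME ∕ TUPLE HOME `RRec₁₂On 𝔯_W1 Rg` (strip currency), AND IN THE ANALYTIC
# SUP-LETTER CURRENCY (A) OF MODULE 4's ROAD-3 CONSUMER (canonical home `RRec₁₂ 𝔯_W1`, regime home, reading of record edition 1) — the complement, BY NAME,
# of dag-n22-c g3's `…N22W1StripN18Edge` (p476424), whose telescoping `oscFading_w1Reading_of_n18At_below` supplies the oscillation-fading input (O) from node N18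

Track A of `YM-PLAN.md` (cell `pub-ymgap`, HUMAN RULING D-0062), R134 seat `pub-ymgap-dag-n22-e` ((T-RATE) pen ∕ N22 NE9 strategy s2 «`FadingMemory` by name from a
modulus + knit at the ₁₂ record»), gen 3, module 7.  THEOREMS ONLY (no `def`, no `sorry`); `--supports` K3″ `SpineGivenEndpointR12` (stmt-QuantumFields-19908) as a
helper; restate-immune (no Theses import).

WHY.  g2's HANDOFF left «(O) = N18's stub at a named reading» as the residual of module 4's ROAD-3 consumer `YMDAG.N22.s_N22_rRec₁₂_w1_of_oscAnalytic` (p467930);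
g0's edge `s_N22_of_s_N18_towerKeyed_analytic` (p452282) needs ONE domain ∕ background type for all run lengths, which W1's reading (per-run-length carriers
`W1.Dom (F.P k) θ.τ9.M`, `((𝔇.w1 F θ).pairing k).BgA`) does not have.  dag-n22-c g3's module 9 (p476424, 2026-08-27) re-derived the telescoping ALONG THE LEVEL
PAIRINGS — `YMDAG.N22.W1.oscFading_w1Reading_of_n18At_below`: NE5 at the pairing levels `< k` + the pairing coherence (C1)(C2) + junk-freeness (J) ⇒ (O) at run
length `k` — and landed the edge at the CANONICAL home in the STRIP currency.  ONE ENGINE PER CONTENT (dag-lead's dedup rule): this module CITES that engine and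
adds only what it does not state — (i) the edge at the REGIME ∕ TUPLE home `RRec₁₂On 𝔯 Rg` of module 5 (p468431; guard INSIDE, bundles read AT θ — the home the
θ-keyed K3′ composers read, dag-n27-c XXVIII), strip currency; (ii) the edge in the ANALYTIC SUP-LETTER currency (A) (module 2's slot `n22At_u3OfRecord₁₂_of_oscAnalytic`,
[Balaban1987RG1] p. 263 «(or analytic)»; fed on the W1 object by dag-n22-c g2's `supLetter_functionalOn_of_youngHolo` ∕ `…_of_termwise226StripOlder_lastOut`) at the
canonical home, the regime home and the reading of record (edition 1, module 6 p469629) — so that module 4's ROAD 3 now reads `S_N18` BY NAME instead of a displayed (O).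
The coherence ∕ junk binder `hcoh` is dag-n22-c's VERBATIM (one discharge serves both currencies; at W1's reading data OF RECORD it is their module 10's theorem).

WHAT THIS MODULE PROVES ([folklore] bookkeeping; every estimate stays a displayed hypothesis).
* §1 **`s_N22_rRec₁₂On_w1Assignment_of_s_N18_stripBound`** — regime home, strip currency: `S_N18 (RRec₁₂On 𝔯_W1 Rg)` + (per admissible tuple with provisos IN `Rg`)
  `hcoh`, the numerals, STRIP per run length ⇒ `S_N22 (RRec₁₂On 𝔯_W1 Rg)` (dag-n22-c's θ-form `n22At_u3OfRecord₁₂_w1Reading_of_n18Below_stripBound` + module 5's faces).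
* §2 analytic currency: θ-form **`n22At_u3OfRecord₁₂_w1_of_n18Below_analytic`** (N18 below `k` + `hcoh` + (A) at run length `k` + numerals ⇒ `N22At` at the level-`k`
  bundle; (P) W1's theorem, letter equations `rfl`) · **`s_N22_rRec₁₂_w1_of_s_N18_analytic`** (canonical home) · **`s_N22_rRec₁₂On_w1_of_s_N18_analytic`** (regime home) ·
  `s_N22_readingOfRecord₁₂_of_s_N18_analytic` (reading of record, edition 1).

HONEST FRAMING.  COUNT-NEUTRAL kernel bookkeeping BY NAME; NE5 ∕ NE9 NOT PRINTED for d = 4 ([Balaban1987RG1] Thm 1 p. 259 gives only uniformity in the lattice spacing,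
p. 263 «C^∞ (or analytic)» in the last coupling) and NOT PROVED; N18's stub, STRIP ∕ (A), `hcoh` and the numerals are DISPLAYED hypotheses; the towers `(𝔇.w1 F θ).S k`
are residual DATA — a termless tower satisfies everything here (module 4 §4: INHABITATION IS NOT CONTENT), so a discharge keyed to the reading NAMES its towers; nothing
of Bałaban's is asserted; no inhabitant of any Stage-12 key claimed (K0″ open); N22 NOT discharged; counts UNMOVED (typed 28∕28 · discharged 5∕27, A 5∕28); one finite
four-torus programme at fixed `ε` — NOT ℝ⁴, NOT infinite volume, NOT OS, NOT a mass gap, NOT Clay.  No decl carries a cite tag.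
-/

noncomputable section

namespace YMDAG.N22

open Set Metric
open scoped BigOperators
open Literature.MathematicalPhysics.QuantumFieldTheory.Balaban1983to89
open Literature.MathematicalPhysics.QuantumFieldTheory.Balaban1983to89.T4Continuum
open Literature.MathematicalPhysics.QuantumFieldTheory.Balaban1983to89.T4OutputRate
open Literature.MathematicalPhysics.QuantumFieldTheory.Balaban1983to89.TreeLengthTorus (torusTreeLen)
open Literature.MathematicalPhysics.QuantumFieldTheory.Balaban1983to89.Node00
  (Stage12Params IsDatumOfRecord₁₂C NE2Objects₁₁ NE3Letters₁₁ MatA)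
open Literature.MathematicalPhysics.QuantumFieldTheory.Balaban1983to89.Node00.Sect2 (domSys CPair)
open Literature.MathematicalPhysics.QuantumFieldTheory.Balaban1983to89.Node00.W1 (ReadingData AssignmentInputs₁₂ assignment₁₂ termC)
open YMDAG.UVSplit
open YMDAG.N22.W1 (oscFading_w1Reading_of_n18At_below n22At_u3OfRecord₁₂_w1Reading_of_n18Below_stripBound)

variable {N : ℕ} [NeZero N]

/-! ## §1 The edge at the regime ∕ tuple home `RRec₁₂On 𝔯_W1 Rg`, strip currency -/

section RegimeStrip

variable (𝔇 : AssignmentInputs₁₂ N) (ne1 : (F : T4Family) → Stage12Params F N → (ℕ → ℝ) → List (ULoop F) → NE1pCarriers)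
  (Rg : (F : T4Family) → Stage12Params F N → Prop)

open Classical in
/-- **THE EDGE N18 → N22 AT THE NAMED W1 READING, REGIME ∕ TUPLE HOME, STRIP CURRENCY.**  For `𝔯_W1 := RateReading₁₂.ofAssignment (W1.assignment₁₂ 𝔇) ne1` and ANY regime
`Rg`: `S_N18 (RRec₁₂On 𝔯_W1 Rg)` (NE5 at every admissible tuple with provisos IN `Rg`, every run length — module 5's `s_N18_rRec₁₂On_iff`) together with, per such tuple,
dag-n22-c's coherence ∕ junk binder `hcoh` for `𝔇.w1 F θ`, the inputs' numerals and STRIP-(1.18) per run length (their `hstrip` verbatim) ⟹ `S_N22 (RRec₁₂On 𝔯_W1 Rg)` —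
their θ-form `n22At_u3OfRecord₁₂_w1Reading_of_n18Below_stripBound` read through module 5's guarded θ-forms.  Every hypothesis is asked ONLY in the regime. [folklore] -/
theorem s_N22_rRec₁₂On_w1Assignment_of_s_N18_stripBound
    (h18 : S_N18 (RRec₁₂On (RateReading₁₂.ofAssignment (assignment₁₂ 𝔇) ne1) Rg))
    (hcoh : ∀ (F : T4Family) (θ : Stage12Params F N), θ.Provisos₁₂ F N → Rg F θ → θ.Admissible F N →
      (∀ (k : ℕ) (X₁ : Node00.W1.Dom (F.P k) θ.τ9.M), (((𝔇.w1 F θ).pairing k).pair X₁).1 = X₁.1 + 1) ∧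
      (∀ (k : ℕ) (X₁ : Node00.W1.Dom (F.P k) θ.τ9.M),
        (domSys (F.P (k + 1)) θ.τ9.M (((𝔇.w1 F θ).pairing k).pair X₁).1).dj (((𝔇.w1 F θ).pairing k).pair X₁).2 =
          (domSys (F.P k) θ.τ9.M X₁.1).dj X₁.2) ∧
      (∀ (k : ℕ) (X : Node00.W1.Dom (F.P (k + 1)) θ.τ9.M), 1 ≤ X.1 → ∃ X₁ : Node00.W1.Dom (F.P k) θ.τ9.M, ((𝔇.w1 F θ).pairing k).pair X₁ = X) ∧
      (∀ (k : ℕ) (U : ((𝔇.w1 F θ).pairing (k + 1)).BgA), ∃ U₁ : ((𝔇.w1 F θ).pairing k).BgB,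
        ((𝔇.w1 F θ).pairing k).embB U₁ = ((𝔇.w1 F θ).pairing (k + 1)).embA U) ∧
      (∀ (k : ℕ) (g : ℕ → ℝ) (U : ((𝔇.w1 F θ).pairing k).BgA) (X : Node00.W1.Dom (F.P k) θ.τ9.M), k < X.1 →
        ((𝔇.w1 F θ).pairing k).EA ((𝔇.w1 F θ).S k) g U X = 0))
    (hnum : ∀ (F : T4Family) (θ : Stage12Params F N), θ.Provisos₁₂ F N → Rg F θ → θ.Admissible F N →
      0 < (𝔇.w1 F θ).li.C₀ ∧ 0 < (𝔇.w1 F θ).li.θ₅ ∧ (𝔇.w1 F θ).li.θ₅ < 1 ∧ 0 ≤ (𝔇.w1 F θ).li.C₅ ∧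
        2 * (𝔇.w1 F θ).li.C₅ / (1 - (𝔇.w1 F θ).li.θ₅) ≤ (𝔇.w1 F θ).li.C₀ ∧ 0 < (𝔇.w1 F θ).li.A ∧ (𝔇.w1 F θ).li.θ₅ ≤ (𝔇.w1 F θ).li.μ ∧
        (𝔇.w1 F θ).li.C₀ ≤ 2 * (𝔇.w1 F θ).li.A ∧ 0 < (𝔇.w1 F θ).li.r ∧ 0 < (𝔇.w1 F θ).li.s ∧ (𝔇.w1 F θ).li.s < 1 ∧ 1 ≤ (𝔇.w1 F θ).li.μ)
    (hstrip : ∀ (F : T4Family) (θ : Stage12Params F N), θ.Provisos₁₂ F N → Rg F θ → θ.Admissible F N → ∀ (k : ℕ),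
      ∃ sp : (j : ℕ) → (domSys (F.P k) θ.τ9.M j).Dom → Set (CPair (F.P k) (MatA N)),
        (∀ (j : ℕ) (U : ((𝔇.w1 F θ).pairing k).BgA) (Y : (domSys (F.P k) θ.τ9.M j).Dom), ((𝔇.w1 F θ).pairing k).embA U ∈ sp j Y) ∧
        (∀ (j : ℕ) (g : ℕ → ℝ), g ∈ Window θ.γ → ∀ (i : ℕ) (Y : (domSys (F.P k) θ.τ9.M j).Dom) (ψ : CPair (F.P k) (MatA N)), ψ ∈ sp j Y →
          ∃ (Ec : ℂ → ℂ) (O : Set ℂ), IsOpen O ∧ (∀ t ∈ Ioc (0 : ℝ) θ.γ, closedBall (t : ℂ) (𝔇.w1 F θ).li.r ⊆ O) ∧ DifferentiableOn ℂ Ec O ∧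
            (∀ z ∈ O, ‖Ec z‖ ≤ (𝔇.w1 F θ).li.A * Real.exp (-((𝔇.w1 F θ).li.κ * torusTreeLen Y.1))) ∧
            (∀ t ∈ Ioc (0 : ℝ) θ.γ, Ec t = termC ((𝔇.w1 F θ).S k) j Y (Function.update g i t) ψ))) :
    S_N22 (RRec₁₂On (RateReading₁₂.ofAssignment (assignment₁₂ 𝔇) ne1) Rg) := by
  rw [s_N22_rRec₁₂On_iff]
  rw [s_N18_rRec₁₂On_iff] at h18
  intro F θ hP hRg hθ g₀ os k
  obtain ⟨hfst, hdj, hsurj, hbg, hjunk⟩ := hcoh F θ hP hRg hθ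
  obtain ⟨hC₀, hθ5, hθ1, hC5, hC₀', hA, hθμ, hCM, hr, hs0, hs1, hμ1⟩ := hnum F θ hP hRg hθ
  obtain ⟨sp, hsp, hall⟩ := hstrip F θ hP hRg hθ k
  exact n22At_u3OfRecord₁₂_w1Reading_of_n18Below_stripBound θ (𝔇.w1 F θ) k sp hsp hall hfst hdj hsurj hbg hjunk
    (fun k' _ => h18 F θ hP hRg hθ g₀ os k') hC5 hθ1 hC₀' hC₀ hθ5 hA hμ1 hθμ hCM hr hθ.toStage9.gamma_pos hs0 hs1

end RegimeStrip

/-! ## §2 The edge in the analytic sup-letter currency (A): module 4's ROAD-3 consumer fed by node N18 BY NAME -/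

section ThetaAnalytic

variable {F : T4Family} (θ : Stage12Params F N) (D : ReadingData F (MatA N) θ.τ9.M) (k : ℕ)

/-- **N18 BELOW `k` ⇒ N22 AT `k`, AT ONE STAGE-12 TUPLE, ANALYTIC SUP-LETTER CURRENCY.**  For W1 reading data `D` (objects `u := D.u3Objects θ.γ`): `N18At` at the bundles
`u3OfRecord₁₂ θ u k′`, `k′ < k`; dag-n22-c's coherence (C1)(C2) and junk-freeness (J) of `D` (their five binders verbatim); the analytic letter (A) at run length `k`
(module 4's `hA` literal: per young coupling `i < j` a complex-differentiable extension of `t ↦ u.EA k (g[i ↦ t]) U X` on a set containing the CLOSED `li.r`-discs about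
`]0, θ.γ]` with sup letter `li.A·li.μ^{j−1−i}·e^{−κ d_j(X)}`); the numerals `0 < li.C₀`, `0 < li.θ₅ < 1`, `0 ≤ li.C₅`, `2·li.C₅∕(1−li.θ₅) ≤ li.C₀`, `0 < li.A`, `li.θ₅ ≤ li.μ`,
`li.C₀ ≤ 2·li.A`, `0 < li.r`, `0 < li.s < 1`; `0 < θ.γ` ⟹ `N22At (u3OfRecord₁₂ θ u k)` — (O) := dag-n22-c's `oscFading_w1Reading_of_n18At_below` at `C₀ := li.C₀`, (P) := W1's
`prefixDependenceOn_u3Objects_EA`, letter equations `u3Objects_ω ∕ _C₉` (`rfl`), module 2's `n22At_u3OfRecord₁₂_of_oscAnalytic`. [folklore] -/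
theorem n22At_u3OfRecord₁₂_w1_of_n18Below_analytic
    (h18 : ∀ k' : ℕ, k' < k → N18At (u3OfRecord₁₂ θ (D.u3Objects θ.γ) k'))
    (hfst : ∀ (k : ℕ) (X₁ : Node00.W1.Dom (F.P k) θ.τ9.M), ((D.pairing k).pair X₁).1 = X₁.1 + 1)
    (hdj : ∀ (k : ℕ) (X₁ : Node00.W1.Dom (F.P k) θ.τ9.M),
      (domSys (F.P (k + 1)) θ.τ9.M ((D.pairing k).pair X₁).1).dj ((D.pairing k).pair X₁).2 = (domSys (F.P k) θ.τ9.M X₁.1).dj X₁.2)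
    (hsurj : ∀ (k : ℕ) (X : Node00.W1.Dom (F.P (k + 1)) θ.τ9.M), 1 ≤ X.1 → ∃ X₁ : Node00.W1.Dom (F.P k) θ.τ9.M, (D.pairing k).pair X₁ = X)
    (hbg : ∀ (k : ℕ) (U : (D.pairing (k + 1)).BgA), ∃ U₁ : (D.pairing k).BgB, (D.pairing k).embB U₁ = (D.pairing (k + 1)).embA U)
    (hjunk : ∀ (k : ℕ) (g : ℕ → ℝ) (U : (D.pairing k).BgA) (X : Node00.W1.Dom (F.P k) θ.τ9.M), k < X.1 → (D.pairing k).EA (D.S k) g U X = 0)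
    (hA : ∀ g ∈ Window θ.γ, ∀ (U : ((D.u3Objects θ.γ).levelCarriers k).BgA) (X : ((D.u3Objects θ.γ).levelCarriers k).Dom) (i : ℕ),
      i < ((D.u3Objects θ.γ).levelCarriers k).scale X → ∃ (Fz : ℂ → ℂ) (Dset : Set ℂ), DifferentiableOn ℂ Fz Dset ∧
        (∀ z ∈ Dset, ‖Fz z‖ ≤ D.li.A * D.li.μ ^ (((D.u3Objects θ.γ).levelCarriers k).scale X - 1 - i) *
          Real.exp (-((D.u3Objects θ.γ).κ * ((D.u3Objects θ.γ).levelCarriers k).d X))) ∧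
        (∀ t ∈ Ioc (0 : ℝ) θ.γ, closedBall (t : ℂ) D.li.r ⊆ Dset) ∧
        (∀ t ∈ Ioc (0 : ℝ) θ.γ, Fz t = ((D.u3Objects θ.γ).EA k (Function.update g i t) U X : ℂ)))
    (hnum : 0 < D.li.C₀ ∧ 0 < D.li.θ₅ ∧ D.li.θ₅ < 1 ∧ 0 ≤ D.li.C₅ ∧ 2 * D.li.C₅ / (1 - D.li.θ₅) ≤ D.li.C₀ ∧ 0 < D.li.A ∧ D.li.θ₅ ≤ D.li.μ ∧
      D.li.C₀ ≤ 2 * D.li.A ∧ 0 < D.li.r ∧ 0 < D.li.s ∧ D.li.s < 1)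
    (hγ : 0 < θ.γ) :
    N22At (u3OfRecord₁₂ θ (D.u3Objects θ.γ) k) := by
  obtain ⟨hC₀, hθ5, hθ1, hC5, hC₀', hA0, hθμ, hCM, hr, hs0, hs1⟩ := hnum
  exact n22At_u3OfRecord₁₂_of_oscAnalytic θ _ k (D.prefixDependenceOn_u3Objects_EA θ.γ k (Window θ.γ))
    (oscFading_w1Reading_of_n18At_below θ D k hfst hdj hsurj hbg hjunk hC5 hθ5.le hθ1 hC₀' h18) hA hC₀ hθ5 hA0 hθμ hCM hr hγ hs0 hs1
    (D.u3Objects_ω θ.γ) (D.u3Objects_C₉ θ.γ)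

end ThetaAnalytic

section StubAnalytic

variable (𝔇 : AssignmentInputs₁₂ N) (ne1 : (F : T4Family) → Stage12Params F N → (ℕ → ℝ) → List (ULoop F) → NE1pCarriers)

/-- **THE EDGE N18 → N22 AT THE NAMED W1 READING, CANONICAL HOME, ANALYTIC CURRENCY.**  `S_N18 (RRec₁₂ 𝔯_W1)` and — per admissible Stage-12 tuple with provisos —
dag-n22-c's `hcoh` for `𝔇.w1 F θ`, the analytic letter (A) at every run length (module 4's `hA` verbatim) and the numerals ⟹ `S_N22 (RRec₁₂ 𝔯_W1)`: at each datum key all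
run lengths are bundles of record at the canonical parameter (layer B's `s_N18_rRec₁₂_iff` ∕ module 4's `s_N22_rRec₁₂_w1_iff`), so §2 applies level by level.  This is module
4's `s_N22_rRec₁₂_w1_of_oscAnalytic` with its (O) hypothesis REPLACED by `S_N18` + `hcoh`. [folklore] -/
theorem s_N22_rRec₁₂_w1_of_s_N18_analytic (h18 : S_N18 (RRec₁₂ (RateReading₁₂.ofAssignment (assignment₁₂ 𝔇) ne1)))
    (hcoh : ∀ (F : T4Family) (θ : Stage12Params F N), θ.Provisos₁₂ F N → θ.Admissible F N →
      (∀ (k : ℕ) (X₁ : Node00.W1.Dom (F.P k) θ.τ9.M), (((𝔇.w1 F θ).pairing k).pair X₁).1 = X₁.1 + 1) ∧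
      (∀ (k : ℕ) (X₁ : Node00.W1.Dom (F.P k) θ.τ9.M),
        (domSys (F.P (k + 1)) θ.τ9.M (((𝔇.w1 F θ).pairing k).pair X₁).1).dj (((𝔇.w1 F θ).pairing k).pair X₁).2 =
          (domSys (F.P k) θ.τ9.M X₁.1).dj X₁.2) ∧
      (∀ (k : ℕ) (X : Node00.W1.Dom (F.P (k + 1)) θ.τ9.M), 1 ≤ X.1 → ∃ X₁ : Node00.W1.Dom (F.P k) θ.τ9.M, ((𝔇.w1 F θ).pairing k).pair X₁ = X) ∧
      (∀ (k : ℕ) (U : ((𝔇.w1 F θ).pairing (k + 1)).BgA), ∃ U₁ : ((𝔇.w1 F θ).pairing k).BgB,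
        ((𝔇.w1 F θ).pairing k).embB U₁ = ((𝔇.w1 F θ).pairing (k + 1)).embA U) ∧
      (∀ (k : ℕ) (g : ℕ → ℝ) (U : ((𝔇.w1 F θ).pairing k).BgA) (X : Node00.W1.Dom (F.P k) θ.τ9.M), k < X.1 →
        ((𝔇.w1 F θ).pairing k).EA ((𝔇.w1 F θ).S k) g U X = 0))
    (hA : ∀ (F : T4Family) (θ : Stage12Params F N), θ.Provisos₁₂ F N → θ.Admissible F N → ∀ (k : ℕ),
      ∀ g ∈ Window θ.γ, ∀ (U : (((𝔇.w1 F θ).u3Objects θ.γ).levelCarriers k).BgA) (X : (((𝔇.w1 F θ).u3Objects θ.γ).levelCarriers k).Dom) (i : ℕ),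
        i < (((𝔇.w1 F θ).u3Objects θ.γ).levelCarriers k).scale X → ∃ (Fz : ℂ → ℂ) (Dset : Set ℂ), DifferentiableOn ℂ Fz Dset ∧
          (∀ z ∈ Dset, ‖Fz z‖ ≤ (𝔇.w1 F θ).li.A * (𝔇.w1 F θ).li.μ ^ ((((𝔇.w1 F θ).u3Objects θ.γ).levelCarriers k).scale X - 1 - i) *
            Real.exp (-(((𝔇.w1 F θ).u3Objects θ.γ).κ * (((𝔇.w1 F θ).u3Objects θ.γ).levelCarriers k).d X))) ∧
          (∀ t ∈ Ioc (0 : ℝ) θ.γ, closedBall (t : ℂ) (𝔇.w1 F θ).li.r ⊆ Dset) ∧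
          (∀ t ∈ Ioc (0 : ℝ) θ.γ, Fz t = (((𝔇.w1 F θ).u3Objects θ.γ).EA k (Function.update g i t) U X : ℂ)))
    (hnum : ∀ (F : T4Family) (θ : Stage12Params F N), θ.Provisos₁₂ F N → θ.Admissible F N →
      0 < (𝔇.w1 F θ).li.C₀ ∧ 0 < (𝔇.w1 F θ).li.θ₅ ∧ (𝔇.w1 F θ).li.θ₅ < 1 ∧ 0 ≤ (𝔇.w1 F θ).li.C₅ ∧
        2 * (𝔇.w1 F θ).li.C₅ / (1 - (𝔇.w1 F θ).li.θ₅) ≤ (𝔇.w1 F θ).li.C₀ ∧ 0 < (𝔇.w1 F θ).li.A ∧ (𝔇.w1 F θ).li.θ₅ ≤ (𝔇.w1 F θ).li.μ ∧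
        (𝔇.w1 F θ).li.C₀ ≤ 2 * (𝔇.w1 F θ).li.A ∧ 0 < (𝔇.w1 F θ).li.r ∧ 0 < (𝔇.w1 F θ).li.s ∧ (𝔇.w1 F θ).li.s < 1) :
    S_N22 (RRec₁₂ (RateReading₁₂.ofAssignment (assignment₁₂ 𝔇) ne1)) := by
  rw [s_N22_rRec₁₂_w1_iff]
  rw [s_N18_rRec₁₂_iff] at h18
  intro F D h k
  obtain ⟨hfst, hdj, hsurj, hbg, hjunk⟩ := hcoh F h.params h.provisos h.admissible
  exact n22At_u3OfRecord₁₂_w1_of_n18Below_analytic h.params (𝔇.w1 F h.params) k (fun k' _ => h18 F D h (fun _ => 0) [] k') hfst hdj hsurj hbg hjunk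
    (hA F h.params h.provisos h.admissible k) (hnum F h.params h.provisos h.admissible) h.gamma_pos

/-- **THE SAME AT THE REGIME ∕ TUPLE HOME** `RRec₁₂On 𝔯_W1 Rg` (any regime `Rg`; module 5's guarded θ-forms; the hypotheses asked only of the admissible tuples with provisos
in the regime). [folklore] -/
theorem s_N22_rRec₁₂On_w1_of_s_N18_analytic (Rg : (F : T4Family) → Stage12Params F N → Prop)
    (h18 : S_N18 (RRec₁₂On (RateReading₁₂.ofAssignment (assignment₁₂ 𝔇) ne1) Rg))
    (hcoh : ∀ (F : T4Family) (θ : Stage12Params F N), θ.Provisos₁₂ F N → Rg F θ → θ.Admissible F N →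
      (∀ (k : ℕ) (X₁ : Node00.W1.Dom (F.P k) θ.τ9.M), (((𝔇.w1 F θ).pairing k).pair X₁).1 = X₁.1 + 1) ∧
      (∀ (k : ℕ) (X₁ : Node00.W1.Dom (F.P k) θ.τ9.M),
        (domSys (F.P (k + 1)) θ.τ9.M (((𝔇.w1 F θ).pairing k).pair X₁).1).dj (((𝔇.w1 F θ).pairing k).pair X₁).2 =
          (domSys (F.P k) θ.τ9.M X₁.1).dj X₁.2) ∧
      (∀ (k : ℕ) (X : Node00.W1.Dom (F.P (k + 1)) θ.τ9.M), 1 ≤ X.1 → ∃ X₁ : Node00.W1.Dom (F.P k) θ.τ9.M, ((𝔇.w1 F θ).pairing k).pair X₁ = X) ∧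
      (∀ (k : ℕ) (U : ((𝔇.w1 F θ).pairing (k + 1)).BgA), ∃ U₁ : ((𝔇.w1 F θ).pairing k).BgB,
        ((𝔇.w1 F θ).pairing k).embB U₁ = ((𝔇.w1 F θ).pairing (k + 1)).embA U) ∧
      (∀ (k : ℕ) (g : ℕ → ℝ) (U : ((𝔇.w1 F θ).pairing k).BgA) (X : Node00.W1.Dom (F.P k) θ.τ9.M), k < X.1 →
        ((𝔇.w1 F θ).pairing k).EA ((𝔇.w1 F θ).S k) g U X = 0))
    (hA : ∀ (F : T4Family) (θ : Stage12Params F N), θ.Provisos₁₂ F N → Rg F θ → θ.Admissible F N → ∀ (k : ℕ),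
      ∀ g ∈ Window θ.γ, ∀ (U : (((𝔇.w1 F θ).u3Objects θ.γ).levelCarriers k).BgA) (X : (((𝔇.w1 F θ).u3Objects θ.γ).levelCarriers k).Dom) (i : ℕ),
        i < (((𝔇.w1 F θ).u3Objects θ.γ).levelCarriers k).scale X → ∃ (Fz : ℂ → ℂ) (Dset : Set ℂ), DifferentiableOn ℂ Fz Dset ∧
          (∀ z ∈ Dset, ‖Fz z‖ ≤ (𝔇.w1 F θ).li.A * (𝔇.w1 F θ).li.μ ^ ((((𝔇.w1 F θ).u3Objects θ.γ).levelCarriers k).scale X - 1 - i) *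
            Real.exp (-(((𝔇.w1 F θ).u3Objects θ.γ).κ * (((𝔇.w1 F θ).u3Objects θ.γ).levelCarriers k).d X))) ∧
          (∀ t ∈ Ioc (0 : ℝ) θ.γ, closedBall (t : ℂ) (𝔇.w1 F θ).li.r ⊆ Dset) ∧
          (∀ t ∈ Ioc (0 : ℝ) θ.γ, Fz t = (((𝔇.w1 F θ).u3Objects θ.γ).EA k (Function.update g i t) U X : ℂ)))
    (hnum : ∀ (F : T4Family) (θ : Stage12Params F N), θ.Provisos₁₂ F N → Rg F θ → θ.Admissible F N →
      0 < (𝔇.w1 F θ).li.C₀ ∧ 0 < (𝔇.w1 F θ).li.θ₅ ∧ (𝔇.w1 F θ).li.θ₅ < 1 ∧ 0 ≤ (𝔇.w1 F θ).li.C₅ ∧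
        2 * (𝔇.w1 F θ).li.C₅ / (1 - (𝔇.w1 F θ).li.θ₅) ≤ (𝔇.w1 F θ).li.C₀ ∧ 0 < (𝔇.w1 F θ).li.A ∧ (𝔇.w1 F θ).li.θ₅ ≤ (𝔇.w1 F θ).li.μ ∧
        (𝔇.w1 F θ).li.C₀ ≤ 2 * (𝔇.w1 F θ).li.A ∧ 0 < (𝔇.w1 F θ).li.r ∧ 0 < (𝔇.w1 F θ).li.s ∧ (𝔇.w1 F θ).li.s < 1) :
    S_N22 (RRec₁₂On (RateReading₁₂.ofAssignment (assignment₁₂ 𝔇) ne1) Rg) := by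
  rw [s_N22_rRec₁₂On_iff]
  rw [s_N18_rRec₁₂On_iff] at h18
  intro F θ hP hRg hθ g₀ os k
  obtain ⟨hfst, hdj, hsurj, hbg, hjunk⟩ := hcoh F θ hP hRg hθ
  exact n22At_u3OfRecord₁₂_w1_of_n18Below_analytic θ (𝔇.w1 F θ) k (fun k' _ => h18 F θ hP hRg hθ g₀ os k') hfst hdj hsurj hbg hjunk
    (hA F θ hP hRg hθ k) (hnum F θ hP hRg hθ) hθ.toStage9.gamma_pos

/-- **THE SAME AT THE READING OF RECORD, EDITION 1** (module 6's `readingOfRecord₁₂ w1 ℓ₃ ne2 ne1`, canonical home; `ℓ₃ ∕ ne2 ∕ ne1` idle): §2's canonical-home edge at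
`𝔇 := pinnedInputs₁₂ w1 ℓ₃ ne2` (`𝔇.w1 = w1` by `rfl`). [folklore] -/
theorem s_N22_readingOfRecord₁₂_of_s_N18_analytic
    (w1 : (F : T4Family) → (θ : Stage12Params F N) → ReadingData F (MatA N) θ.τ9.M) (ℓ₃ : T4Family → NE3Letters₁₁)
    (ne2 : (F : T4Family) → Stage12Params F N → (ℕ → ℝ) → List (ULoop F) → ℕ → NE2Objects₁₁)
    (h18 : S_N18 (RRec₁₂ (readingOfRecord₁₂ w1 ℓ₃ ne2 ne1)))
    (hcoh : ∀ (F : T4Family) (θ : Stage12Params F N), θ.Provisos₁₂ F N → θ.Admissible F N →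
      (∀ (k : ℕ) (X₁ : Node00.W1.Dom (F.P k) θ.τ9.M), (((w1 F θ).pairing k).pair X₁).1 = X₁.1 + 1) ∧
      (∀ (k : ℕ) (X₁ : Node00.W1.Dom (F.P k) θ.τ9.M),
        (domSys (F.P (k + 1)) θ.τ9.M (((w1 F θ).pairing k).pair X₁).1).dj (((w1 F θ).pairing k).pair X₁).2 = (domSys (F.P k) θ.τ9.M X₁.1).dj X₁.2) ∧
      (∀ (k : ℕ) (X : Node00.W1.Dom (F.P (k + 1)) θ.τ9.M), 1 ≤ X.1 → ∃ X₁ : Node00.W1.Dom (F.P k) θ.τ9.M, ((w1 F θ).pairing k).pair X₁ = X) ∧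
      (∀ (k : ℕ) (U : ((w1 F θ).pairing (k + 1)).BgA), ∃ U₁ : ((w1 F θ).pairing k).BgB, ((w1 F θ).pairing k).embB U₁ = ((w1 F θ).pairing (k + 1)).embA U) ∧
      (∀ (k : ℕ) (g : ℕ → ℝ) (U : ((w1 F θ).pairing k).BgA) (X : Node00.W1.Dom (F.P k) θ.τ9.M), k < X.1 → ((w1 F θ).pairing k).EA ((w1 F θ).S k) g U X = 0))
    (hA : ∀ (F : T4Family) (θ : Stage12Params F N), θ.Provisos₁₂ F N → θ.Admissible F N → ∀ (k : ℕ),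
      ∀ g ∈ Window θ.γ, ∀ (U : (((w1 F θ).u3Objects θ.γ).levelCarriers k).BgA) (X : (((w1 F θ).u3Objects θ.γ).levelCarriers k).Dom) (i : ℕ),
        i < (((w1 F θ).u3Objects θ.γ).levelCarriers k).scale X → ∃ (Fz : ℂ → ℂ) (Dset : Set ℂ), DifferentiableOn ℂ Fz Dset ∧
          (∀ z ∈ Dset, ‖Fz z‖ ≤ (w1 F θ).li.A * (w1 F θ).li.μ ^ ((((w1 F θ).u3Objects θ.γ).levelCarriers k).scale X - 1 - i) *
            Real.exp (-(((w1 F θ).u3Objects θ.γ).κ * (((w1 F θ).u3Objects θ.γ).levelCarriers k).d X))) ∧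
          (∀ t ∈ Ioc (0 : ℝ) θ.γ, closedBall (t : ℂ) (w1 F θ).li.r ⊆ Dset) ∧
          (∀ t ∈ Ioc (0 : ℝ) θ.γ, Fz t = (((w1 F θ).u3Objects θ.γ).EA k (Function.update g i t) U X : ℂ)))
    (hnum : ∀ (F : T4Family) (θ : Stage12Params F N), θ.Provisos₁₂ F N → θ.Admissible F N →
      0 < (w1 F θ).li.C₀ ∧ 0 < (w1 F θ).li.θ₅ ∧ (w1 F θ).li.θ₅ < 1 ∧ 0 ≤ (w1 F θ).li.C₅ ∧
        2 * (w1 F θ).li.C₅ / (1 - (w1 F θ).li.θ₅) ≤ (w1 F θ).li.C₀ ∧ 0 < (w1 F θ).li.A ∧ (w1 F θ).li.θ₅ ≤ (w1 F θ).li.μ ∧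
        (w1 F θ).li.C₀ ≤ 2 * (w1 F θ).li.A ∧ 0 < (w1 F θ).li.r ∧ 0 < (w1 F θ).li.s ∧ (w1 F θ).li.s < 1) :
    S_N22 (RRec₁₂ (readingOfRecord₁₂ w1 ℓ₃ ne2 ne1)) :=
  s_N22_rRec₁₂_w1_of_s_N18_analytic (pinnedInputs₁₂ w1 ℓ₃ ne2) ne1 h18 hcoh hA hnum

end StubAnalytic

end YMDAG.N22

end
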